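import Summits.FinalStateConjecture.FinalStateConjecture.Theses.BondiDrainDispersal
import Literature.Geometry.Lorentzian.CausalityPushUp
import Literature.Geometry.Lorentzian.CausalityOpennessProofs
import Literature.Geometry.Lorentzian.CausalityChronologyProofs
import Literature.Geometry.Lorentzian.NormalisedNullRayCausal
import Literature.Geometry.Lorentzian.LeviCivitaProofs
import HarnessLib

/-!
# Crux `DrainImpliesDisperse` (stmt-FinalStateConjecture-17283), negative side:
# the filed text is false on a drained censored development carrying a persistently pulsed observer

`Theses.BondiDrainDispersal.DrainImpliesDisperse` (verbatim `Theses.NoNullFinalMomentum.DrainImpliesDisperse`)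
asserts, for EVERY admissible datum (`admissibleVacuumData`: Dafermos–Rodnianski rates `o₂(r⁻¹)`/`o₁(r⁻²)`,
two derivatives of `h` and one of `k` controlled at infinity) and every maximal vacuum Cauchy development
`𝒟` with complete `𝓘⁺` (sojourn form) and vanishing final Bondi mass, an honest DISPERSIVE decomposition:
`∃ O (d : FinalStateDecomposition 𝒟 O 2), d.N = 0 ∧ O = exteriorOf 𝒟 d.charted ∧ RaysStayInClosure 𝒟 O ∧
HasExhaustiveCharts d ∧ IsFutureOriented d` — a flat chart `Ψ` of the late half-space `{x⁰ > τ₀}` whose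
`C²` deviation from `η`, a `sup` over the ENTIRE slabs `{x⁰ = τ}`, tends to `0`, exhausting
`O = J⁺(ι X) ∩ I⁻(Ψ{x⁰ > τ₀})`, with every future-complete normalised null ray from the data inside
`closure O`.

Line lead c3 (`Cruxes/DrainImpliesDisperse/REPORT-c3.md`; kit job j024863; kernel-checked calculus core
`Literature.Analysis.PDE.not_bddAbove_deriv_deriv_focalValue`) observed that the `C²` conclusion is
linearly inconsistent with the data class: solutions of wave equations in three space dimensions lose
one derivative at a focus (F. John 1982, Ch. 5 §1), and the admissible class admits far-field ripples
`ε r⁻¹⁰ sin(r⁴)` — `o₂(r⁻¹)`-small, of arbitrarily small energy — which focus to curvature pulses of size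
`≍ 64 ε` at the events `(t_n, 0)`, `t_n = (2πn)^{1/4} → ∞`, of the central worldline, forever. The expected
maximal development of such a datum (small data in every norm but the weighted `C³` ones; Burnett /
high-frequency regime) is causally geodesically complete, has complete `𝓘⁺`, drains (final Bondi mass
`0`), and its central timelike geodesic `c` is a PERSISTENTLY PULSED OBSERVER:

* (T) `c` is a future timelike curve on `[0, ∞)`;
* (R) every event `c s`, `s ≥ 0`, lies on a future-complete normalised null ray from the data at an affine
  parameter `≥ 0` (shoot a past null geodesic from `c s` to the Cauchy hypersurface and reverse it);
* (V) the observer sees every event to the future of the data: `∀ a ∈ J⁺(ι X), ∃ s ≥ 0, a ≪ c s` (no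
  event horizon for `c`, which reaches future timelike infinity of the asymptotically Minkowskian
  development);
* (W) a frame-independent `C²` floor `δ > 0` recurs along `c` at arbitrarily late parameters: for
  `s = t_n`, NO local chart of the flat background through `c s` (an open subset `U ⊆ E4`, a smooth
  `Φ : U → M` which is an open embedding near a point `x` with `Φ x = c s`) is `δ`-quiet in `C²` at `x`
  (`δ ≤ sup_{m ≤ 2} ‖D^m(Φ^*g − η)(x)‖`): the quadratic curvature invariants at the pulse events are
  bounded below (the focused `ℓ = 2` tidal field is algebraically general), and a `C²`-`δ'`-quiet chart at
  `x` forces them to be `O(δ')`;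
* (A) chart rigidity of the development: every late chart of the flat background on an ENTIRE late
  half-space `{x⁰ > τ₀} ⊆ U` into `J⁺(ι X)` whose `C²` deviation on entire slabs tends to `0` and whose
  chart time is eventually future-oriented has eventually ACHRONAL slabs `Φ{x⁰ = τ}` (in a complete
  near-Minkowskian development a uniformly spacelike entire slab has complete induced metric, hence is a
  properly embedded entire graph over a Cauchy time, hence achronal — Harris-type rigidity).

On such a development the crux fails, and THIS FILE PROVES EXACTLY THAT, as causal geometry over the
filed text (`drainImpliesDisperse_false_of_pulsedObserver`, binder form): given the `N = 0` decomposition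
`d` the crux would provide, with flat chart `Ψ`,
1. the worldline lies in `O` (`worldline_mem_exteriorOf`): `c (s+1)` is on a complete ray, so in
   `closure O ⊆ closure I⁻(U)` by `RaysStayInClosure`; the open set `I⁺(c s) ∋ c (s+1)` then meets `I⁻(U)`,
   so `c s ≪ q ≪ U`; and `c s ∈ J⁺(ι X)` by its own ray;
2. by (A), `deviationCk → 0` and `IsFutureOriented`, some late slab `Σ = Ψ{x⁰ = τ₁}` is achronal and it
   and all later slabs are `δ`-quiet (`deviationCk … 2 τ < δ`, `τ ≥ τ₁`); its point `a₀ = Ψ(τ₁, 0, 0, 0)`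
   lies in `O ⊆ J⁺(ι X)`, so by (V) and (W) some LATER pulse event `c s` satisfies `a₀ ≪ c s`;
3. `c s` lies in the flat chart's late region `Ψ{x⁰ > τ₁}`: otherwise `HasExhaustiveCharts` (at `N = 0`:
   `O ∖ Ψ{x⁰ > τ₁} ⊆ J⁻(Σ)`, `diff_lateRegion_subset_causalPast_slab_of_N_eq_zero`) gives `c s ≤ a ∈ Σ`,
   and push-up (O'Neill 1983, Cor. 14.1, reversed orientation) turns `a₀ ≪ c s ≤ a` into `a₀ ≪ a`, against
   achronality (`not_mem_causalPast_of_isAchronal`);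
4. so `c s = Ψ x` with `x⁰ > τ₁`, and (W) applied to the flat chart itself gives
   `δ ≤ ‖(Ψ^*g − η)‖_{C²}(x) ≤ deviationCk … 2 (x⁰) < δ`.

The witness is packaged as the construction hypothesis `PulsedObserverDevelopmentExists` (the `H` of the
negative-modulo lane; an MGHD-level object — no maximal development of any non-flat admissible datum is
constructible in the tree today, exactly as for the massless-hole channel), and we record
`PulsedObserverDevelopmentExists → ¬ DrainImpliesDisperse`. This is a NEGATIVE LEMMA MODULO `H`, not a
refutation; it certifies that the truth value of the item AS FILED is decided by far-field regularity
bookkeeping (REPORT-c3 §5: repair C′ = Christodoulou–Klainerman class data,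
`IsStronglyAsymptoticallyFlatCK`, under which (W) is expected to fail for every development and line
`registered` survives verbatim). Steps 1–3 are, positively read, the statement every future line needs:
HONEST `N = 0` SLABS REACH EVERY PERSISTENTLY VISIBLE OBSERVER.

References: B. O'Neill, *Semi-Riemannian geometry* (1983), Ch. 14, Lemma 14.3, Cor. 14.1, p. 402;
F. John, *Partial Differential Equations* (4th ed., 1982), Ch. 5 §1; S. G. Harris, Class. Quantum
Grav. 5 (1988) 111 (closed and complete spacelike hypersurfaces); G. Burnett, J. Math. Phys. 30 (1989)
90; C. Huneau, J. Luk, Duke Math. J. 167 (2018); D. Christodoulou, S. Klainerman 1993, (1.0.9).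
Line lead `prover-line-stmt-FinalStateConjecture-17283-c4-0`, 2026-08-17.
-/

noncomputable section

-- D-0017: single-problem summit, `Summit.<S>.<S>.…` by design (cf. lakefile `weak.linter.dupNamespace`).
set_option linter.dupNamespace false

open Set Filter Function TopologicalSpace Topology
open scoped Manifold ContDiff Topology

namespace Summit.FinalStateConjecture.FinalStateConjecture.Theorems.DrainImpliesDisperse.Negative

open Literature.Geometry.Lorentzian
open Summit.FinalStateConjecture (HasCompleteNullInfinity exteriorOf RaysStayInClosure HasExhaustiveCharts
  IsFutureOriented certifiedLate certifiedSlab)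
open Summit.FinalStateConjecture.FinalStateConjecture.Theses.BondiDrainDispersal (DrainImpliesDisperse)

/-! ### Regularity side condition -/

/-- `1 ≤ ∞` in `ℕ∞ω` (regularity side condition of the push-up lemma). [folklore] -/
private lemma one_le_infty : (1 : ℕ∞ω) ≤ ((⊤ : ℕ∞) : ℕ∞ω) := WithTop.coe_le_coe.mpr le_top

/-! ### Causal lemmas (any time-oriented Lorentzian manifold without boundary) -/

section Causal

variable {E : Type*} [NormedAddCommGroup E] [NormedSpace ℝ E] {H : Type*} [TopologicalSpace H]
  {I : ModelWithCorners ℝ E H} {n : ℕ∞ω} {M : Type*} [TopologicalSpace M] [ChartedSpace H M]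
  [IsManifold I ∞ M] {g : LorentzianMetric I n M} {τ : TimeOrientation g}

/-- The final point of a future timelike segment lies in the chronological future of its initial point:
`γ b ∈ I⁺(γ a)` for `γ` future timelike on `[a, b]`, `a < b`. O'Neill 1983, Ch. 14, p. 402.
[cite: ONeillSemiRiemannian1983, Ch. 14, p. 402] -/
theorem mem_chronologicalFuture_of_timelikeCurve {γ : ℝ → M} {a b : ℝ} (hab : a < b)
    (hγ : g.IsFutureTimelikeCurveOn τ γ (Icc a b)) : γ b ∈ g.chronologicalFuture τ {γ a} :=
  ⟨γ a, rfl, γ, a, b, hab, hγ, rfl, rfl⟩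

/-- **Closure-to-past transfer.** On a manifold without boundary: if `x ≪ y` and `y ∈ closure (I⁻(U))`
then `x ∈ I⁻(U)` — the open set `I⁺(x) ∋ y` (O'Neill 1983, Lemma 14.3) meets `I⁻(U)` in some `q`, and
`x ≪ q ≪ U` (transitivity of `≪`, O'Neill 1983, Ch. 14, p. 402).
[cite: ONeillSemiRiemannian1983, Ch. 14, Lemma 14.3 (p. 403)] -/
theorem mem_chronologicalPast_of_mem_closure [BoundarylessManifold I M] {U : Set M} {x y : M}
    (hxy : y ∈ g.chronologicalFuture τ {x}) (hy : y ∈ closure (g.chronologicalPast τ U)) :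
    x ∈ g.chronologicalPast τ U := by
  obtain ⟨q, hqx, hqU⟩ := mem_closure_iff_nhds.mp hy _
    ((LorentzianMetric.isOpen_chronologicalFuture_of_boundaryless g τ {x}).mem_nhds hxy)
  exact LorentzianMetric.mem_chronologicalFuture_trans hqU
    (LorentzianMetric.mem_chronologicalPast_of_mem_chronologicalFuture hqx)

/-- **An achronal set cannot causally precede an event in the chronological future of one of its
points.** If `S` is achronal, `a₀ ∈ S` and `a₀ ≪ y`, then `y ∉ J⁻(S)`: otherwise `y ≤ a` for some `a ∈ S`
and push-up for the reversed time orientation (O'Neill 1983, Ch. 14, Cor. 14.1: `a₀ ≪ y ≤ a ⟹ a₀ ≪ a`)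
contradicts achronality. Equivalently `J⁻(S) ∩ I⁺(a₀) = ∅` for every `a₀ ∈ S`.
[cite: ONeillSemiRiemannian1983, Ch. 14, Cor. 14.1 (p. 402)] -/
theorem not_mem_causalPast_of_isAchronal [BoundarylessManifold I M] [FiniteDimensional ℝ E]
    (hn : 1 ≤ n) {S : Set M} (hS : g.IsAchronal τ S) {a₀ y : M} (ha₀ : a₀ ∈ S)
    (hy : y ∈ g.chronologicalFuture τ {a₀}) : y ∉ g.causalPast τ S := by
  intro hyS
  change y ∈ g.causalFuture τ.reverse S at hyS
  rw [LorentzianMetric.causalFuture_eq_biUnion] at hyS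
  simp only [mem_iUnion, exists_prop] at hyS
  obtain ⟨a, haS, hya⟩ := hyS
  have ha₀y : a₀ ∈ g.chronologicalPast τ {y} :=
    LorentzianMetric.mem_chronologicalPast_of_mem_chronologicalFuture hy
  have ha₀a : a₀ ∈ g.chronologicalFuture τ.reverse {a} :=
    LorentzianMetric.mem_chronologicalFuture_of_mem_causalFuture (τ := τ.reverse) hn hya ha₀y
  exact hS a₀ ha₀ a haS (LorentzianMetric.mem_chronologicalFuture_of_mem_chronologicalPast ha₀a)

end Causal

/-! ### Honest `N = 0` decompositions: exhaustion by the flat chart alone -/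

/-- **Exhaustion at `N = 0`.** For a final-state decomposition without holes the clause
`HasExhaustiveCharts` reads: for every chart time `τ₁ > τ₀`, every point of `O` outside the flat chart's
image of `{x⁰ > τ₁}` lies in the causal past of the flat slab `Ψ({x⁰ = τ₁} ∩ U₀)` (the `Fin 0`-indexed
hole pieces of `certifiedLate`/`certifiedSlab` are empty). [folklore] -/
theorem diff_lateRegion_subset_causalPast_slab_of_N_eq_zero {𝓢 : Spacetime 4} {O : Set 𝓢.carrier}
    {k : ℕ} (d : FinalStateDecomposition 𝓢 O k) (hN : d.N = 0) (h : HasExhaustiveCharts d) {τ₁ : ℝ}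
    (hτ₁ : d.τ₀ < τ₁) :
    O \ d.flatChart '' (Minkowski.backgroundOn d.flatDomain).lateRegion τ₁ ⊆
      𝓢.metric.causalPast 𝓢.timeOrientation
        (d.flatChart '' (Minkowski.backgroundOn d.flatDomain).timeSlab τ₁) := by
  obtain ⟨R, -, -, hex⟩ := h
  haveI : IsEmpty (Fin d.N) := by rw [hN]; infer_instance
  have h1 := hex τ₁ hτ₁
  rwa [certifiedLate, certifiedSlab, iUnion_of_empty, union_empty, iUnion_of_empty, union_empty] at h1

/-! ### The persistently pulsed observer -/

section Development

variable {X : Type} [TopologicalSpace X] [ChartedSpace E3 X] [IsManifold (𝓡 3) ∞ X]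
  [ConnectedSpace X] {D : InitialDataSet (𝓡 3) X}

/-- **A ray-borne future timelike worldline lies in the exterior region.** Let `O = exteriorOf 𝒟 U =
J⁺(ι X) ∩ I⁻(U)` satisfy `RaysStayInClosure 𝒟 O`, and let `c` be a future timelike curve on `[0, ∞)`
each of whose events `c s`, `s ≥ 0`, lies on a future-complete normalised null ray from the data at an
affine parameter `≥ 0`. Then `c s ∈ O` for every `s ≥ 0`: `c s ∈ J⁺(ι X)` by its ray
(`IsNormalisedNullRayFrom.mem_causalFuture_range`); `c (s+1) ∈ closure O ⊆ closure I⁻(U)` by the ray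
clause, and `c s ≪ c (s+1)`, so `c s ∈ I⁻(U)` (`mem_chronologicalPast_of_mem_closure`). The Levi-Civita
instance quantified in the clauses exists outright (`PseudoRiemannianMetric.hasLeviCivita`).
[cite: ONeillSemiRiemannian1983, Ch. 14, Lemma 14.3 (p. 403)] -/
theorem worldline_mem_exteriorOf (𝒟 : CauchyDevelopment D) {O U : Set 𝒟.carrier}
    (hO : O = exteriorOf 𝒟 U) (hrays : RaysStayInClosure 𝒟 O) {c : ℝ → 𝒟.carrier}
    (hc : 𝒟.metric.IsFutureTimelikeCurveOn 𝒟.timeOrientation c (Ici 0))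
    (hray : ∀ [𝒟.metric.HasLeviCivita], ∀ s : ℝ, 0 ≤ s →
      ∃ (p : X) (γ : ℝ → 𝒟.carrier) (dom : Set ℝ) (t : ℝ),
        𝒟.metric.IsNormalisedNullRayFrom 𝒟.timeOrientation 𝒟.embed 𝒟.normal p γ dom ∧
          ¬ BddAbove dom ∧ t ∈ dom ∧ 0 ≤ t ∧ γ t = c s)
    {s : ℝ} (hs : 0 ≤ s) : c s ∈ O := by
  haveI : 𝒟.metric.HasLeviCivita := PseudoRiemannianMetric.hasLeviCivita _
  -- `c s ∈ J⁺(ι X)` by its own ray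
  obtain ⟨p, γ, dom, t, hγ, -, ht, ht0, hγt⟩ := hray s hs
  have hJ : c s ∈ 𝒟.metric.causalFuture 𝒟.timeOrientation (range 𝒟.embed) := by
    rw [← hγt]
    exact hγ.mem_causalFuture_range ht ht0
  -- `c (s + 1) ∈ closure O` by the ray through it, and `c s ≪ c (s + 1)`
  obtain ⟨p', γ', dom', t', hγ', hdom', ht', ht0', hγt'⟩ := hray (s + 1) (by linarith)
  have hcl : c (s + 1) ∈ closure O := by
    rw [← hγt']
    exact hrays p' γ' dom' hγ' hdom' t' ht' ht0'
  have hsub : O ⊆ 𝒟.metric.chronologicalPast 𝒟.timeOrientation U := by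
    rw [hO]
    exact inter_subset_right
  have hcurve : c (s + 1) ∈ 𝒟.metric.chronologicalFuture 𝒟.timeOrientation {c s} :=
    mem_chronologicalFuture_of_timelikeCurve (lt_add_one s)
      (hc.mono fun r hr ↦ mem_Ici.mpr (hs.trans hr.1))
  rw [hO]
  exact ⟨hJ, mem_chronologicalPast_of_mem_closure hcurve (closure_mono hsub hcl)⟩

/-- **`DrainImpliesDisperse` is false on a drained censored development carrying a persistently pulsed
observer** (binder form; the hypotheses are exactly the fields of `PulsedObserverDevelopmentExists`).
Given an admissible datum, a maximal vacuum Cauchy development `𝒟` with complete `𝓘⁺` and vanishing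
final Bondi mass, a future timelike curve `c` on `[0, ∞)` with (R) every `c s`, `s ≥ 0`, on a
future-complete normalised null ray from the data at a parameter `≥ 0`, (V) `∀ a ∈ J⁺(ι X), ∃ s ≥ 0,
a ≪ c s`, (W) for every `s₀` a later parameter `s > s₀` at which no local chart of the flat background
through `c s` is `δ`-quiet in `C²` (`δ ≤ supCkENorm {x} 2 (Φ^*g − η)` whenever `Φ : U → M` is smooth, an
open embedding of an open `V ∋ x`, `Φ x = c s`), `0 < δ`, and (A) every entire, `C²`-asymptotically flat,
eventually future-oriented late chart of the flat background into `J⁺(ι X)` has eventually achronal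
slabs: then the crux fails. Proof (module docstring, steps 1–4): the crux's `N = 0` decomposition has a
late achronal `δ`-quiet slab `Σ = Ψ{x⁰ = τ₁}` with `a₀ = Ψ(τ₁,0,0,0) ∈ O`; a pulse event `c s ≫ a₀`
lies in `O` (`worldline_mem_exteriorOf`), hence in `Ψ{x⁰ > τ₁}` (else `HasExhaustiveCharts` and push-up
put `a₀ ≪ a ∈ Σ`, `not_mem_causalPast_of_isAchronal`), where (W) contradicts
`deviationCk … 2 (x⁰) < δ`. [cite: ONeillSemiRiemannian1983, Ch. 14, Cor. 14.1 (p. 402)] -/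
theorem drainImpliesDisperse_false_of_pulsedObserver (X : Type) [TopologicalSpace X]
    [ChartedSpace E3 X] [IsManifold (𝓡 3) ∞ X] [T2Space X] [SecondCountableTopology X]
    [ConnectedSpace X] (D : InitialDataSet (𝓡 3) X) (hD : D ∈ admissibleVacuumData X)
    (𝒟 : VacuumCauchyDevelopment D) (hmax : 𝒟.IsMaximal)
    (hcni : HasCompleteNullInfinity 𝒟.toCauchyDevelopment)
    (hdrain : 𝒟.toCauchyDevelopment.HasVanishingFinalBondiMass)
    (c : ℝ → 𝒟.carrier) (δ : ENNReal) (hδ : 0 < δ)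
    (hc : 𝒟.metric.IsFutureTimelikeCurveOn 𝒟.timeOrientation c (Ici 0))
    (hray : ∀ [𝒟.metric.HasLeviCivita], ∀ s : ℝ, 0 ≤ s →
      ∃ (p : X) (γ : ℝ → 𝒟.carrier) (dom : Set ℝ) (t : ℝ),
        𝒟.metric.IsNormalisedNullRayFrom 𝒟.timeOrientation 𝒟.embed 𝒟.normal p γ dom ∧
          ¬ BddAbove dom ∧ t ∈ dom ∧ 0 ≤ t ∧ γ t = c s)
    (hvis : ∀ a ∈ 𝒟.metric.causalFuture 𝒟.timeOrientation (range 𝒟.embed),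
      ∃ s : ℝ, 0 ≤ s ∧ c s ∈ 𝒟.metric.chronologicalFuture 𝒟.timeOrientation {a})
    (hwild : ∀ s₀ : ℝ, ∃ s : ℝ, s₀ < s ∧
      ∀ (U : Opens E4) (Φ : (Minkowski.backgroundOn U).domain → 𝒟.carrier)
        (V : Set (Minkowski.backgroundOn U).domain) (x : (Minkowski.backgroundOn U).domain),
        IsOpen V → x ∈ V → ContMDiff 𝓘(ℝ, E4) (𝓡 4) ∞ Φ → IsOpenEmbedding (V.restrict Φ) →
        Φ x = c s →
        δ ≤ supCkENorm {(x : E4)} 2 (𝒟.toSpacetime.deviationExtend (Minkowski.backgroundOn U) Φ))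
    (hach : ∀ (U : Opens E4) (τ₀ : ℝ) (Φ : (Minkowski.backgroundOn U).domain → 𝒟.carrier),
      Minkowski.lateRegion τ₀ ⊆ (U : Set E4) →
      𝒟.toSpacetime.IsLateChart (Minkowski.backgroundOn U)
        (𝒟.metric.causalFuture 𝒟.timeOrientation (range 𝒟.embed)) τ₀ Φ →
      Tendsto (fun τ ↦ 𝒟.toSpacetime.deviationCk (Minkowski.backgroundOn U) Φ 2 τ) atTop (𝓝 0) →
      (∀ᶠ τ in atTop, ∀ x ∈ (Minkowski.backgroundOn U).timeSlab τ,
        𝒟.timeOrientation.IsFutureDirected (mfderiv 𝓘(ℝ, E4) (𝓡 4) Φ x (E4.basisVector 0))) →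
      ∀ᶠ τ in atTop, 𝒟.metric.IsAchronal 𝒟.timeOrientation
        (Φ '' (Minkowski.backgroundOn U).timeSlab τ)) :
    ¬ DrainImpliesDisperse := by
  intro hS
  obtain ⟨O, d, hN, hO, hrays, hexh, hfut⟩ := hS X D hD 𝒟 hmax hcni hdrain
  have hlate : 𝒟.toSpacetime.IsLateChart (Minkowski.backgroundOn d.flatDomain) O d.τ₀ d.flatChart :=
    d.isLateChart_flat
  have hOJ : O ⊆ 𝒟.metric.causalFuture 𝒟.timeOrientation (range 𝒟.embed) := by
    rw [hO]
    exact inter_subset_left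
  -- (A): the flat chart's slabs are eventually achronal
  have hA : ∀ᶠ τ in atTop, 𝒟.metric.IsAchronal 𝒟.timeOrientation
      (d.flatChart '' (Minkowski.backgroundOn d.flatDomain).timeSlab τ) :=
    hach d.flatDomain d.τ₀ d.flatChart (d.lateRegion_subset_flatDomain_of_N_eq_zero hN)
      ⟨hlate.contMDiff, hlate.isOpenEmbedding, hlate.image_subset.trans hOJ⟩
      d.tendsto_deviationCk_flat hfut.2.2
  -- eventually the `C²` deviation on entire flat slabs is `< δ`
  have hdev : ∀ᶠ τ in atTop,
      𝒟.toSpacetime.deviationCk (Minkowski.backgroundOn d.flatDomain) d.flatChart 2 τ < δ :=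
    (tendsto_order.1 d.tendsto_deviationCk_flat).2 δ hδ
  obtain ⟨T, hT⟩ := eventually_atTop.1 (hA.and hdev)
  -- a late chart time `τ₁ > τ₀`, `τ₁ ≥ T`
  obtain ⟨τ₁, hτ₁T, hτ₁0⟩ : ∃ τ₁ : ℝ, T ≤ τ₁ ∧ d.τ₀ < τ₁ :=
    ⟨max T (d.τ₀ + 1), le_max_left _ _, (lt_add_one _).trans_le (le_max_right _ _)⟩
  have hachr := (hT τ₁ hτ₁T).1
  -- the slab point `a₀ = Ψ (τ₁, 0, 0, 0)`
  have hz0 : (τ₁ • E4.basisVector 0 : E4) 0 = τ₁ := by simp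
  have hzU : (τ₁ • E4.basisVector 0 : E4) ∈ (d.flatDomain : Set E4) :=
    d.lateRegion_subset_flatDomain_of_N_eq_zero hN
      (show d.τ₀ < (τ₁ • E4.basisVector 0 : E4) 0 by rw [hz0]; exact hτ₁0)
  let x₀ : (Minkowski.backgroundOn d.flatDomain).domain := ⟨τ₁ • E4.basisVector 0, hzU⟩
  have hx₀slab : x₀ ∈ (Minkowski.backgroundOn d.flatDomain).timeSlab τ₁ :=
    show (τ₁ • E4.basisVector 0 : E4) 0 = τ₁ from hz0
  have hx₀late : x₀ ∈ (Minkowski.backgroundOn d.flatDomain).lateRegion d.τ₀ :=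
    show d.τ₀ < (τ₁ • E4.basisVector 0 : E4) 0 by rw [hz0]; exact hτ₁0
  have ha₀O : d.flatChart x₀ ∈ O := hlate.image_subset (mem_image_of_mem d.flatChart hx₀late)
  -- the observer sees `a₀`; a later pulse event `c s ≫ a₀`
  obtain ⟨s₀, hs₀, hvis₀⟩ := hvis (d.flatChart x₀) (hOJ ha₀O)
  obtain ⟨s, hs₀s, hws⟩ := hwild s₀
  have hs : 0 ≤ s := hs₀.trans hs₀s.le
  have hcs : c s ∈ 𝒟.metric.chronologicalFuture 𝒟.timeOrientation {d.flatChart x₀} :=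
    LorentzianMetric.mem_chronologicalFuture_trans hvis₀
      (mem_chronologicalFuture_of_timelikeCurve hs₀s
        (hc.mono fun r hr ↦ mem_Ici.mpr (hs₀.trans hr.1)))
  -- `c s ∈ O`, hence in the flat chart's late region after `τ₁`
  have hcsO : c s ∈ O := worldline_mem_exteriorOf 𝒟.toCauchyDevelopment hO hrays hc hray hs
  have hcsL : c s ∈ d.flatChart '' (Minkowski.backgroundOn d.flatDomain).lateRegion τ₁ := by
    by_contra hnot
    exact not_mem_causalPast_of_isAchronal one_le_infty hachr (mem_image_of_mem d.flatChart hx₀slab)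
      hcs (diff_lateRegion_subset_causalPast_slab_of_N_eq_zero d hN hexh hτ₁0 ⟨hcsO, hnot⟩)
  obtain ⟨x, hxlate, hxcs⟩ := hcsL
  have hxlate' : τ₁ < (x : E4) 0 := hxlate
  -- (W) at `c s = Ψ x` against `deviationCk … 2 (x⁰) < δ`
  have hopen : IsOpen ((Minkowski.backgroundOn d.flatDomain).lateRegion d.τ₀) := by
    have hc0 : Continuous fun y : E4 ↦ y 0 := PiLp.continuous_apply 2 _ 0
    exact isOpen_lt continuous_const (hc0.comp continuous_subtype_val)
  have hxlate0 : x ∈ (Minkowski.backgroundOn d.flatDomain).lateRegion d.τ₀ :=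
    (Minkowski.backgroundOn d.flatDomain).lateRegion_mono hτ₁0.le hxlate
  have hle := hws d.flatDomain d.flatChart ((Minkowski.backgroundOn d.flatDomain).lateRegion d.τ₀) x
    hopen hxlate0 hlate.contMDiff hlate.isOpenEmbedding hxcs
  have hxslab : (x : E4) ∈
      Subtype.val '' (Minkowski.backgroundOn d.flatDomain).timeSlab ((x : E4) 0) := ⟨x, rfl, rfl⟩
  have hmono : supCkENorm {(x : E4)} 2
      (𝒟.toSpacetime.deviationExtend (Minkowski.backgroundOn d.flatDomain) d.flatChart) ≤
      𝒟.toSpacetime.deviationCk (Minkowski.backgroundOn d.flatDomain) d.flatChart 2 ((x : E4) 0) :=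
    supCkENorm_mono (singleton_subset_iff.mpr hxslab) 2 _
  have hlt : 𝒟.toSpacetime.deviationCk (Minkowski.backgroundOn d.flatDomain) d.flatChart 2
      ((x : E4) 0) < δ :=
    (hT ((x : E4) 0) (hτ₁T.trans hxlate'.le)).2
  exact absurd (hle.trans hmono) (not_le.mpr hlt)

end Development

/-- **Construction hypothesis `H` (a drained censored development with a persistently pulsed observer).**
Some admissible datum has a maximal vacuum Cauchy development `𝒟` with complete future null infinity
(sojourn form) and vanishing final Bondi mass, together with a curve `c : ℝ → M` and a floor
`0 < δ ≤ ∞`, such that: (T) `c` is a future timelike curve on `[0, ∞)`; (R) every event `c s`, `s ≥ 0`, lies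
on a future-complete normalised null ray from the data hypersurface at an affine parameter `≥ 0`;
(V) every event of `J⁺(ι X)` is chronologically seen by the observer, `∀ a ∈ J⁺(ι X), ∃ s ≥ 0, a ≪ c s`;
(W) for every `s₀` there is `s > s₀` such that no local chart of the flat background through `c s` is
`δ`-quiet in `C²` there — for every open `U ⊆ E4`, smooth `Φ : U → M`, open `V ⊆ U` on which `Φ` is an
open embedding, and `x ∈ V` with `Φ x = c s`: `δ ≤ supCkENorm {x} 2 (Φ^* g − η)`; (A) every late chart
`Φ` of the flat background over an open `U ⊇ {x⁰ > τ₀}` into `J⁺(ι X)` (`Spacetime.IsLateChart`) whose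
`C²` deviation on the entire slabs `{x⁰ = τ}` tends to `0` and whose push-forward of `∂₀` is eventually
future-directed on the slabs has eventually ACHRONAL slabs `Φ{x⁰ = τ}`. Expected on paper for the
maximal development of the time-symmetric admissible datum obtained by the conformal method from the
far-field ripple `δ + ε r⁻¹⁰ sin(r⁴) w₀` (`Cruxes/DrainImpliesDisperse/REPORT-c3.md` §§2–3, kit job
j024863, `Literature.Analysis.PDE.not_bddAbove_deriv_deriv_focalValue`): `c` the central timelike
geodesic, `δ ≍ ε` the focused tidal floor at the pulse times `t_n = (2πn)^{1/4}` (3D focusing loses one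
derivative; the `o₂(r⁻¹)` class does not control `∂³h`), (R)/(V) by causal geodesic completeness and the
asymptotically Minkowskian causal structure, (A) by Harris-type rigidity of complete spacelike entire
slabs. NOT constructible in the tree today (no maximal development of any non-flat admissible datum).
This is the construction hypothesis `H` of a negative lemma, not a published fact (no citation tag). -/
def PulsedObserverDevelopmentExists : Prop :=
  ∃ (X : Type) (_ : TopologicalSpace X) (_ : ChartedSpace E3 X) (_ : IsManifold (𝓡 3) ∞ X)
    (_ : T2Space X) (_ : SecondCountableTopology X) (_ : ConnectedSpace X)
    (D : InitialDataSet (𝓡 3) X) (_ : D ∈ admissibleVacuumData X) (𝒟 : VacuumCauchyDevelopment D)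
    (_ : 𝒟.IsMaximal) (_ : HasCompleteNullInfinity 𝒟.toCauchyDevelopment)
    (_ : 𝒟.toCauchyDevelopment.HasVanishingFinalBondiMass) (c : ℝ → 𝒟.carrier) (δ : ENNReal),
    0 < δ ∧
    𝒟.metric.IsFutureTimelikeCurveOn 𝒟.timeOrientation c (Ici 0) ∧
    (∀ [𝒟.metric.HasLeviCivita], ∀ s : ℝ, 0 ≤ s →
      ∃ (p : X) (γ : ℝ → 𝒟.carrier) (dom : Set ℝ) (t : ℝ),
        𝒟.metric.IsNormalisedNullRayFrom 𝒟.timeOrientation 𝒟.embed 𝒟.normal p γ dom ∧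
          ¬ BddAbove dom ∧ t ∈ dom ∧ 0 ≤ t ∧ γ t = c s) ∧
    (∀ a ∈ 𝒟.metric.causalFuture 𝒟.timeOrientation (range 𝒟.embed),
      ∃ s : ℝ, 0 ≤ s ∧ c s ∈ 𝒟.metric.chronologicalFuture 𝒟.timeOrientation {a}) ∧
    (∀ s₀ : ℝ, ∃ s : ℝ, s₀ < s ∧
      ∀ (U : Opens E4) (Φ : (Minkowski.backgroundOn U).domain → 𝒟.carrier)
        (V : Set (Minkowski.backgroundOn U).domain) (x : (Minkowski.backgroundOn U).domain),
        IsOpen V → x ∈ V → ContMDiff 𝓘(ℝ, E4) (𝓡 4) ∞ Φ → IsOpenEmbedding (V.restrict Φ) →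
        Φ x = c s →
        δ ≤ supCkENorm {(x : E4)} 2 (𝒟.toSpacetime.deviationExtend (Minkowski.backgroundOn U) Φ)) ∧
    (∀ (U : Opens E4) (τ₀ : ℝ) (Φ : (Minkowski.backgroundOn U).domain → 𝒟.carrier),
      Minkowski.lateRegion τ₀ ⊆ (U : Set E4) →
      𝒟.toSpacetime.IsLateChart (Minkowski.backgroundOn U)
        (𝒟.metric.causalFuture 𝒟.timeOrientation (range 𝒟.embed)) τ₀ Φ →
      Tendsto (fun τ ↦ 𝒟.toSpacetime.deviationCk (Minkowski.backgroundOn U) Φ 2 τ) atTop (𝓝 0) →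
      (∀ᶠ τ in atTop, ∀ x ∈ (Minkowski.backgroundOn U).timeSlab τ,
        𝒟.timeOrientation.IsFutureDirected (mfderiv 𝓘(ℝ, E4) (𝓡 4) Φ x (E4.basisVector 0))) →
      ∀ᶠ τ in atTop, 𝒟.metric.IsAchronal 𝒟.timeOrientation
        (Φ '' (Minkowski.backgroundOn U).timeSlab τ))

/-- **Negative lemma modulo `PulsedObserverDevelopmentExists`**: one drained censored maximal
development of one admissible datum carrying a persistently pulsed observer falsifies
`DrainImpliesDisperse` as filed (its conclusion needs the `C²` deviation of the flat chart to tend to `0`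
on ENTIRE late slabs, which by honesty — `RaysStayInClosure`, `HasExhaustiveCharts`, `IsFutureOriented`
— pass through the pulse events). The twin `Theses.NoNullFinalMomentum.DrainImpliesDisperse` has the
same body. [folklore] -/
theorem DrainImpliesDisperse_false_of_pulsedObserverDevelopmentExists
    (H : PulsedObserverDevelopmentExists) : ¬ DrainImpliesDisperse := by
  obtain ⟨X, _, _, _, _, _, _, D, hD, 𝒟, hmax, hcni, hdrain, c, δ, hδ, hc, hray, hvis, hwild, hach⟩ :=
    H
  exact drainImpliesDisperse_false_of_pulsedObserver X D hD 𝒟 hmax hcni hdrain c δ hδ hc hray hvis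
    hwild hach

end Summit.FinalStateConjecture.FinalStateConjecture.Theorems.DrainImpliesDisperse.Negative

end
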